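import Summits.QuantumFields.YangMills.Theses.CoincidenceRotationBootstrap
import Summits.QuantumFields.YangMills.Theorems.IsotropyFromPowerCountingAssembly
import Summits.QuantumFields.YangMills.Theorems.PencilRigidityCurvatureChannel
import Summits.QuantumFields.YangMills.Theorems.LangevinControlUVOSLegsFromFemtoAndGapStubUpgradeGivens
import HarnessLib.Audit

/-!
# Line `mirror-boost-transfer` for crux `CurvatureAmnesia` (item stmt-QuantumFields-16192)

Crux decl `Summit.QuantumFields.YangMills.Theses.CoincidenceRotationBootstrap.CurvatureAmnesia` (shared
verbatim with `ScalingWindowSplit.CurvatureAmnesia`): Σ5 ORIENTATION AMNESIA of the curvature species of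
every weak-coupling Wilson limit carrying the OS guards, the lattice tie, non-triviality and the two gaps.

**Lens: TRANSFER at crux level.**  The solved sibling step is the tree's E1 engine of the sibling cruxes
`MirrorModularBoosts.CurvatureBoostCovariance` (stmt-9663) / `SoftKernelBoostCovariance` (B′, stmt-14999) /
`PencilRigidity.NPointIsotropy` (stmt-11686): planar rotation invariance of the curvature channel of a
Wilson limit from SIXTEEN MIRRORS (reflection positivity in the eight planar frames), the PLANAR SPECTRAL CONE
(proved, `PlanarSpectralCone_of`) and UV POWER COUNTING (the soft kernel K and the heat-sandwich bound Σ with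
tempered moments T; the composition `T → Σ → B′` is LANDED: `engineFromPowerCounting_proof`, item
stmt-17722 closed).  This file proves that `CurvatureAmnesia` is a COROLLARY of four EXISTING items of the
routes `MirrorModularBoosts` / `IsotropyFromPowerCounting`, none of which is an existence or gap statement:

* `stub_curvatureKernelBound`      = `MirrorModularBoosts.CurvatureKernelBound`         (K, stmt-QuantumFields-11687)
* `stub_diagonalMirrorRPR`         = `MirrorModularBoosts.DiagonalMirrorRPR`            (D, stmt-QuantumFields-10604)
* `stub_temperedCurvatureMoments`  = `IsotropyFromPowerCounting.TemperedCurvatureMoments` (T, stmt-QuantumFields-17721)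
* `stub_curvatureSandwichBound`    = `IsotropyFromPowerCounting.CurvatureSandwichBound`   (Σ, stmt-QuantumFields-18372)

`CurvatureAmnesia_of : K → D → T → Σ → CurvatureAmnesia` (sorry-free):
1. the curvature channel `S₁ n := S n (fun _ ↦ r.curvature)` of a family `S` with the crux's hypotheses
   carries the one-species package `W1 r sch S₁` and is reflection positive in the four AXIS frames
   (`w1_of_package`, the label specialisation of `Theorems.curvatureChannel_proof` — which cannot be quoted
   because its package `W` also demands non-Gaussianity, absent from the crux; the weak-coupling and
   non-triviality hypotheses of the crux are not used);
2. the four DIAGONAL frames come from D, so `EightFrameRP S₁`; the cone from the landed `PlanarSpectralCone_of`;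
3. B′ (from T and Σ by the landed engine) fed K's kernel triple gives `PlanarInvariant S₁`: invariance on `⁰𝒮`
   under every determinant-one isometry fixing `e₂, e₃`;
4. the landed `PlanarToEuclidean_holds` (proper signed permutations + planar ⇒ all of `SO(4)`, exact group
   theory) applied to `S₁.toLabelled`, and `det R = 1` for the Σ5 rotation (`det_eq_one_of_sigmaFive`:
   `R = Q_B ∘ ρ_θ ∘ Q_B⁻¹` with `cos θ = 3/5`, `sin θ = -4/5`), give the Σ5 clause.

Why this dodges the stuck point of the registered line `Lines/birth.lean`: there the hard stub
`stub_latticeSigmaFiveBlindness` is the crux's own lattice avatar (equivalent to the crux modulo totality) and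
its only engine is the uncharted non-perturbative `(a/ℓ)²`-irrelevance of the dimension-6 operators.  Here no
stub is a symmetry statement: D is lattice reflection positivity across the diagonal mirrors of Wilson's
plaquette action surviving the limit, K / T / Σ are UV REGULARITY (power-counting) statements about the
renormalised `tr F²` channel — refutable only by `tr F²` acquiring UV dimension ≥ 5 in an asymptotically free
theory — and the symmetry is manufactured by the landed sixteen-mirror boost engine.  All four stubs are
staffed items with their own crux directories; closing them closes this crux by `CurvatureAmnesia_of`.

Negative knowledge honoured: `ledger negatives --problem QuantumFields` (5 entries) — the only nearby one is
the unrepaired `MirrorModularBoosts.DiagonalMirrorRP` (S₁ 0 unconstrained), avoided by consuming the REPAIRED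
item `DiagonalMirrorRPR` whose package `W1` carries E0; the model-blind core of the engine is known false
(`CurvatureBoostCovariance.Negative`: the `W(B₄)`-symmetric generalised free field), which is why K, T, Σ —
tied UV data — are load-bearing and kept as stubs; no `Disproof.lean` exists yet for this crux.
-/

noncomputable section

namespace Summit.QuantumFields.YangMills.Cruxes.CurvatureAmnesia.MirrorBoostTransfer

open scoped BigOperators Topology SchwartzMap
open Filter
open Literature.MathematicalPhysics.QuantumLattice Literature.MathematicalPhysics.AQFT
  Literature.MathematicalPhysics.QuantumFieldTheory
open Summit.QuantumFields.YangMills.Theses.CoincidenceRotationBootstrap (CurvatureAmnesia)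
open Summit.QuantumFields.YangMills.Theorems.CurvatureBoostCovariance.Negative
  (W1 EightFrameRP PlanarCone PlanarInvariant)

/-- `ℝ⁴` (file-local notation). -/
local notation "E4" => EuclideanSpace ℝ (Fin 4)

/-! ## §1 The registered stubs (the ONLY `sorry`s of this file) — four existing items, by name -/

/-- (K) the soft two-point kernel of the curvature channel — item stmt-QuantumFields-11687. -/
theorem stub_curvatureKernelBound :
    Summit.QuantumFields.YangMills.Theses.MirrorModularBoosts.CurvatureKernelBound := by
  sorry

/-- (D) reflection positivity of the curvature channel across the four diagonal mirrors —
item stmt-QuantumFields-10604. -/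
theorem stub_diagonalMirrorRPR :
    Summit.QuantumFields.YangMills.Theses.MirrorModularBoosts.DiagonalMirrorRPR := by
  sorry

/-- (T) tempered renormalised lattice moment densities tied to the curvature channel —
item stmt-QuantumFields-17721. -/
theorem stub_temperedCurvatureMoments :
    Summit.QuantumFields.YangMills.Theses.IsotropyFromPowerCounting.TemperedCurvatureMoments := by
  sorry

/-- (Σ) the transversely filtered heat-sandwich bound with one power of slack, `μ < 4` —
item stmt-QuantumFields-18372. -/
theorem stub_curvatureSandwichBound :
    Summit.QuantumFields.YangMills.Theses.IsotropyFromPowerCounting.CurvatureSandwichBound := by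
  sorry

/-! ### Name-keyed aliases of the four statements (hypotheses of the composition) -/
namespace Registered

/-- Alias of K keyed by the registered stub name. -/
abbrev stub_curvatureKernelBound : Prop :=
  Summit.QuantumFields.YangMills.Theses.MirrorModularBoosts.CurvatureKernelBound
/-- Alias of D keyed by the registered stub name. -/
abbrev stub_diagonalMirrorRPR : Prop :=
  Summit.QuantumFields.YangMills.Theses.MirrorModularBoosts.DiagonalMirrorRPR
/-- Alias of T keyed by the registered stub name. -/
abbrev stub_temperedCurvatureMoments : Prop :=
  Summit.QuantumFields.YangMills.Theses.IsotropyFromPowerCounting.TemperedCurvatureMoments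
/-- Alias of Σ keyed by the registered stub name. -/
abbrev stub_curvatureSandwichBound : Prop :=
  Summit.QuantumFields.YangMills.Theses.IsotropyFromPowerCounting.CurvatureSandwichBound

end Registered

/-! ## §2 Geometry: the Σ5 rotation is proper (no `sorry` below this line) -/

section Geometry

open Summit.QuantumFields.YangMills.Theorems.OSLegsFromFemtoAndGap.Upgrade
open Summit.QuantumFields.YangMills.Theorems.PlanarToEuclidean

/-- The Σ5 clause of the crux (verbatim): `R e₀ = e₀`, `R e₁ = e₁`, `R e₂ = (3e₂+4e₃)/5`,
`R e₃ = (−4e₂+3e₃)/5`. -/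
def IsSigmaFive (R : E4 ≃ₗᵢ[ℝ] E4) : Prop :=
  R (EuclideanSpace.single 0 1) = EuclideanSpace.single 0 1 ∧
    R (EuclideanSpace.single 1 1) = EuclideanSpace.single 1 1 ∧
      R (EuclideanSpace.single 2 1) =
          (3/5 : ℝ) • EuclideanSpace.single 2 1 + (4/5 : ℝ) • EuclideanSpace.single 3 1 ∧
        R (EuclideanSpace.single 3 1) =
          -((4/5 : ℝ) • EuclideanSpace.single 2 1) + (3/5 : ℝ) • EuclideanSpace.single 3 1

/-- A Σ5 isometry is the conjugate `Q ∘ ρ_θ ∘ Q⁻¹` of the `(x₀,x₁)`-rotation by `θ` (`cos θ = 3/5`,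
`sin θ = -4/5`) by any isometry `Q : e₀ ↦ e₂, e₁ ↦ e₃, e₂ ↦ e₀, e₃ ↦ e₁`; hence it has the determinant of
that conjugate. [folklore] -/
theorem det_eq_det_conj_of_isSigmaFive (R : E4 ≃ₗᵢ[ℝ] E4) (hR : IsSigmaFive R) {θ : ℝ}
    (hc : Real.cos θ = 3 / 5) (hs : Real.sin θ = -(4 / 5)) (Q : E4 ≃ₗᵢ[ℝ] E4)
    (hQ0 : Q (EuclideanSpace.single 0 1) = EuclideanSpace.single 2 1)
    (hQ1 : Q (EuclideanSpace.single 1 1) = EuclideanSpace.single 3 1)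
    (hQ2 : Q (EuclideanSpace.single 2 1) = EuclideanSpace.single 0 1)
    (hQ3 : Q (EuclideanSpace.single 3 1) = EuclideanSpace.single 1 1) :
    LinearMap.det (R.toLinearEquiv : E4 →ₗ[ℝ] E4) =
      LinearMap.det ((Q.trans ((planeRot (d := 3) 0 θ).trans Q.symm)).toLinearEquiv : E4 →ₗ[ℝ] E4) := by
  have hQs0 : Q.symm (EuclideanSpace.single 0 1) = EuclideanSpace.single 2 1 := by
    rw [← hQ2, LinearIsometryEquiv.symm_apply_apply]
  have hQs1 : Q.symm (EuclideanSpace.single 1 1) = EuclideanSpace.single 3 1 := by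
    rw [← hQ3, LinearIsometryEquiv.symm_apply_apply]
  have hQs2 : Q.symm (EuclideanSpace.single 2 1) = EuclideanSpace.single 0 1 := by
    rw [← hQ0, LinearIsometryEquiv.symm_apply_apply]
  have hQs3 : Q.symm (EuclideanSpace.single 3 1) = EuclideanSpace.single 1 1 := by
    rw [← hQ1, LinearIsometryEquiv.symm_apply_apply]
  set R' : E4 ≃ₗᵢ[ℝ] E4 := Q.trans ((planeRot (d := 3) 0 θ).trans Q.symm) with hR'
  have h0' : R' (EuclideanSpace.single 0 1) = EuclideanSpace.single 0 1 := by
    rw [hR', LinearIsometryEquiv.trans_apply, LinearIsometryEquiv.trans_apply, hQ0, rho_e2, hQs2]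
  have h1' : R' (EuclideanSpace.single 1 1) = EuclideanSpace.single 1 1 := by
    rw [hR', LinearIsometryEquiv.trans_apply, LinearIsometryEquiv.trans_apply, hQ1, rho_e3, hQs3]
  have h2' : R' (EuclideanSpace.single 2 1) =
      (3 / 5 : ℝ) • EuclideanSpace.single 2 1 + (4 / 5 : ℝ) • EuclideanSpace.single 3 1 := by
    rw [hR', LinearIsometryEquiv.trans_apply, LinearIsometryEquiv.trans_apply, hQ2, rho_e0, map_add,
      map_smul, map_smul, hQs0, hQs1, hc, hs, neg_neg]
  have h3' : R' (EuclideanSpace.single 3 1) =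
      -((4 / 5 : ℝ) • EuclideanSpace.single 2 1) + (3 / 5 : ℝ) • EuclideanSpace.single 3 1 := by
    rw [hR', LinearIsometryEquiv.trans_apply, LinearIsometryEquiv.trans_apply, hQ3, rho_e1, map_add,
      map_smul, map_smul, hQs0, hQs1, hc, hs, neg_smul]
  obtain ⟨hR0, hR1, hR2, hR3⟩ := hR
  have hlin : (R.toLinearEquiv : E4 →ₗ[ℝ] E4) = (R'.toLinearEquiv : E4 →ₗ[ℝ] E4) := by
    refine (EuclideanSpace.basisFun (Fin 4) ℝ).toBasis.ext fun i => ?_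
    simp only [OrthonormalBasis.coe_toBasis, EuclideanSpace.basisFun_apply, LinearEquiv.coe_coe,
      LinearIsometryEquiv.coe_toLinearEquiv]
    fin_cases i
    · exact hR0.trans h0'.symm
    · exact hR1.trans h1'.symm
    · exact hR2.trans h2'.symm
    · exact hR3.trans h3'.symm
  rw [hlin]

/-- **The Σ5 rotation is proper**: `det R = det Q_B · det ρ_θ · det Q_B⁻¹ = 1`. [folklore] -/
theorem det_eq_one_of_isSigmaFive (R : E4 ≃ₗᵢ[ℝ] E4) (hR : IsSigmaFive R) :
    LinearMap.det (R.toLinearEquiv : E4 →ₗ[ℝ] E4) = 1 := by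
  obtain ⟨θ, hc, hs⟩ := exists_cos_eq_and_sin_eq_neg (a := 3 / 5) (b := 4 / 5) (by norm_num)
  obtain ⟨hQdet, hQ0, hQ1, hQ2, hQ3⟩ := QB_spec
  rw [det_eq_det_conj_of_isSigmaFive R hR hc hs _ hQ0 hQ1 hQ2 hQ3, det_trans, hQdet, one_mul, det_trans,
    det_rho, det_symm hQdet, one_mul]

end Geometry

/-! ## §3 The curvature channel of the amnesia package carries `W1` and the axis frames -/

section Channel

open Summit.QuantumFields.YangMills.Theorems.CurvatureChannel

variable {G : Type} [Group G] [TopologicalSpace G] [IsTopologicalGroup G] [CompactSpace G]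
  [MeasurableSpace G] [BorelSpace G]

/-- The guard package of the crux (its second hypothesis, verbatim): E0 (normalisation, hermiticity), E0',
E2, E3, E4, translation invariance and proper-hypercubic invariance on `⁰𝒮`. -/
def Guards {ι : Type} (S : LabelledSchwingerFamily ι E4) : Prop :=
  S.IsNormalized ∧ S.IsHermitian ∧ S.HasLinearGrowth ∧ S.IsReflectionPositive ∧ S.IsSymmetric ∧
    S.HasClusterProperty ∧
    (∀ (n : ℕ) (k : Fin n → ι) (a : E4) (F : 𝓢((Fin n → E4), ℂ)), IsOffDiagonal F →
      S n k (translateMulti a F) = S n k F) ∧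
    (∀ (n : ℕ) (k : Fin n → ι) (R : E4 ≃ₗᵢ[ℝ] E4), LinearMap.det (R.toLinearEquiv : E4 →ₗ[ℝ] E4) = 1 →
      (∀ i : Fin 4, ∃ j : Fin 4, R (EuclideanSpace.single i 1) = EuclideanSpace.single j 1 ∨
        R (EuclideanSpace.single i 1) = -EuclideanSpace.single j 1) →
      ∀ F : 𝓢((Fin n → E4), ℂ), IsOffDiagonal F → S n k (linActMulti R F) = S n k F)

/-- The lattice TIE of the crux (its third hypothesis, verbatim = the body of `IsYangMillsFor`). -/
def IsLatticeLimit (r : LatticeRep G) (sch : SpeciesScheme (YMSpecies G))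
    (S : LabelledSchwingerFamily (YMSpecies G) E4) : Prop :=
  ∀ (n : ℕ), n ≠ 0 → ∀ (σ : Fin n → YMSpecies G) (f : Fin n → 𝓢(E4, ℝ)) (F : 𝓢((Fin n → E4), ℂ)),
    IsTensorOf F (fun i => ofRealTest (f i)) → IsOffDiagonal F →
      Tendsto (fun k : ℕ => ((latticeSchwinger r.ρ sch (fun s => s.F) k n σ f : ℝ) : ℂ)) atTop
        (𝓝 (S n σ F))

/-- Continuum and volume-uniform lattice mass gaps (the crux's fifth hypothesis, verbatim). -/
def HasGaps (r : LatticeRep G) (sch : SpeciesScheme (YMSpecies G))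
    (S : LabelledSchwingerFamily (YMSpecies G) E4) : Prop :=
  ∃ Δ : ℝ, 0 < Δ ∧ S.HasMassGap Δ ∧ HasLatticeMassGap r sch Δ

/-- **Restriction + axis transport for the amnesia package.**  If a labelled family `S` over the
Yang–Mills species carries the crux's guards, its lattice tie and its gaps, then the curvature channel
`S₁ n := S n (fun _ ↦ r.curvature)` carries the one-species package `W1 r sch S₁` of the sibling cruxes and is
reflection positive in pull-back form in the four axis frames `R e₀ ∈ {±e₀, ±e₁}`.  (Label specialisation
exactly as in `Theorems.curvatureChannel_proof`, whose package additionally asks non-triviality and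
non-Gaussianity; neither is used.) [folklore] -/
theorem w1_of_package (r : LatticeRep G) (sch : SpeciesScheme (YMSpecies G))
    (S : LabelledSchwingerFamily (YMSpecies G) E4) (hax : Guards S) (hconv : IsLatticeLimit r sch S)
    (hgaps : HasGaps r sch S) :
    W1 r sch (fun n => S n (fun _ => r.curvature)) ∧
      (∀ (R : E4 ≃ₗᵢ[ℝ] E4) (a b : ℝ), a ^ 2 + b ^ 2 = 1 → (a = 0 ∨ b = 0) →
        R (EuclideanSpace.single 0 1) = a • EuclideanSpace.single 0 1 + b • EuclideanSpace.single 1 1 →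
          (SchwingerFamily.toLabelled
            (fun n => (S n (fun _ => r.curvature)).comp (linActMulti R))).IsReflectionPositive) := by
  obtain ⟨hnorm, hherm, hgrowth, hrp, hsymm, hclus, htr, hhyp⟩ := hax
  obtain ⟨Δ, hΔ, hgap, hlat⟩ := hgaps
  -- E2 of the curvature channel (label specialisation)
  have hrp₁ : (SchwingerFamily.toLabelled (fun n => S n fun _ => r.curvature)).IsReflectionPositive := by
    intro N deg lab F hF H hH
    have h := hrp N deg (fun j _ => r.curvature) F hF H hH
    simp only [append_const_rev] at h
    simpa only [SchwingerFamily.toLabelled_apply] using h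
  -- proper hypercubic invariance of the curvature channel on `⁰𝒮`
  have hhyp₁ : ∀ R : E4 ≃ₗᵢ[ℝ] E4, LinearMap.det (R.toLinearEquiv : E4 →ₗ[ℝ] E4) = 1 →
      (∀ i : Fin 4, ∃ j : Fin 4, R (EuclideanSpace.single i 1) = EuclideanSpace.single j 1 ∨
        R (EuclideanSpace.single i 1) = -EuclideanSpace.single j 1) →
      ∀ (n : ℕ) (F : 𝓢((Fin n → E4), ℂ)), IsOffDiagonal F →
        S n (fun _ => r.curvature) (linActMulti R F) = S n (fun _ => r.curvature) F :=
    fun R hdet hsp n F hF => hhyp n (fun _ => r.curvature) R hdet hsp F hF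
  refine ⟨⟨?_, ⟨?_, ?_, ?_, hrp₁, ?_, ?_⟩, ?_, hhyp₁, Δ, hΔ, ?_, hlat⟩, ?_⟩
  · -- lattice convergence of the curvature strings
    exact fun n hn f F hF hF' => hconv n hn (fun _ => r.curvature) f F hF hF'
  · -- E0 (normalisation)
    exact fun k F => hnorm (fun _ => r.curvature) F
  · -- E0 (hermiticity)
    exact fun n k F hF => hherm n (fun _ => r.curvature) F hF
  · -- E0' with the label alphabet `{r.curvature}`
    intro T
    obtain ⟨s, α, β, h⟩ := hgrowth {r.curvature}
    exact ⟨s, α, β, fun n k _ F hF =>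
      h n (fun _ => r.curvature) (fun _ => Finset.mem_singleton_self _) F hF⟩
  · -- E3
    exact fun n k π F hF => hsymm n (fun _ => r.curvature) π F hF
  · -- E4
    intro n m k k' F G' hF hG' a ha ha' H hH
    have h := hclus n m (fun _ => r.curvature) (fun _ => r.curvature) F G' hF hG' a ha ha' H hH
    rw [append_const_rev] at h
    exact h
  · -- translations
    exact fun n a F hF => htr n (fun _ => r.curvature) a F hF
  · -- the gap of the curvature sector
    exact hgap.restrict fun _ => r.curvature
  · -- reflection positivity in the four axis frames
    intro R a b hab h0 hR
    exact isReflectionPositive_comp_axisFrame (fun n => S n fun _ => r.curvature) hrp₁ hhyp₁ R a b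
      hab h0 hR

end Channel

/-! ## §4 Composition (kernel-checked; concludes the crux BY NAME) -/

/-- **The crux from the sixteen-mirror engine** (B′ as a hypothesis): K, B′ = `SoftKernelBoostCovariance`
and D give `CurvatureAmnesia`.  The curvature channel of the amnesia package carries `W1` and the axis frames
(`w1_of_package`); D adds the diagonal frames; the landed `PlanarSpectralCone_of` gives the cone; B′ fed K's
kernel triple gives invariance under the rotations of the `(x₀,x₁)`-plane; `PlanarToEuclidean_holds` and
`det_eq_one_of_isSigmaFive` give the Σ5 clause. -/
theorem CurvatureAmnesia_of_engine
    (hK : Summit.QuantumFields.YangMills.Theses.MirrorModularBoosts.CurvatureKernelBound)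
    (hB : Summit.QuantumFields.YangMills.Theses.MirrorModularBoosts.SoftKernelBoostCovariance)
    (hD : Summit.QuantumFields.YangMills.Theses.MirrorModularBoosts.DiagonalMirrorRPR) :
    CurvatureAmnesia := by
  intro G _ _ _ _ hG
  letI : MeasurableSpace G := borel G
  haveI : BorelSpace G := ⟨rfl⟩
  intro r sch S _hW hax hconv _hNT hgap R hR n F₀ hF₀
  -- the curvature channel and its one-species package
  obtain ⟨hW₁, hAxis⟩ := w1_of_package r sch S hax hconv hgap
  have hhyp₁ := hW₁.2.2.2.1
  have hgrowth₁ := hW₁.2.1.2.2.1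
  have hsymm₁ := hW₁.2.1.2.2.2.2.1
  have htr₁ := hW₁.2.2.1
  -- the eight planar frames: axis frames by transport, diagonal frames by D
  have h8 : EightFrameRP (fun n => S n (fun _ => r.curvature)) := by
    intro R' a b hab hcase hR'
    rcases hcase with h0 | h0 | h0
    · exact hAxis R' a b hab (Or.inl h0) hR'
    · exact hAxis R' a b hab (Or.inr h0) hR'
    · have ha : a ^ 2 = 1 / 2 := by linarith
      have hb : b ^ 2 = 1 / 2 := by linarith
      exact hD G hG r sch (fun n => S n (fun _ => r.curvature)) hW₁ R' a b ha hb hR'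
  -- the planar spectral cone (landed, model-blind)
  have hcone : PlanarCone (fun n => S n (fun _ => r.curvature)) :=
    Summit.QuantumFields.YangMills.Cruxes.PlanarSpectralCone.PositivityDiscToOperatorCone.PlanarSpectralCone_of
      (fun n => S n (fun _ => r.curvature)) hgrowth₁ hsymm₁ htr₁ h8
  -- the engine below dimension five, fed the kernel triple of K: planar rotations
  have hplanar : PlanarInvariant (fun n => S n (fun _ => r.curvature)) :=
    hB G hG r sch (fun n => S n (fun _ => r.curvature)) hW₁ h8 hcone
      (hK G hG r sch (fun n => S n (fun _ => r.curvature)) hW₁)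
  -- planar + proper hypercubic ⇒ every determinant-one isometry; the Σ5 rotation is one of them
  have hdet : LinearMap.det (R.toLinearEquiv : E4 →ₗ[ℝ] E4) = 1 := det_eq_one_of_isSigmaFive R hR
  exact Summit.QuantumFields.YangMills.Theses.MirrorModularBoosts.PlanarToEuclidean_holds Unit
    (SchwingerFamily.toLabelled (fun n => S n (fun _ => r.curvature)))
    (fun n k A hA hp F hF => hhyp₁ A hA hp n F hF)
    (fun A hA h2 h3 n k F hF => hplanar A hA h2 h3 n F hF) n (fun _ => ()) R hdet F₀ hF₀

/-- **The crux from the four registered stubs** (concludes `CurvatureAmnesia` BY NAME): B′ is obtained from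
T and Σ by the LANDED typed split `engineFromPowerCounting_proof` (item stmt-QuantumFields-17722, closed). -/
theorem CurvatureAmnesia_of (hK : Registered.stub_curvatureKernelBound)
    (hD : Registered.stub_diagonalMirrorRPR) (hT : Registered.stub_temperedCurvatureMoments)
    (hS : Registered.stub_curvatureSandwichBound) : CurvatureAmnesia :=
  CurvatureAmnesia_of_engine hK
    (Summit.QuantumFields.YangMills.Theorems.SoftKernelBoostCovariance.Sketch.engineFromPowerCounting_proof
      hT hS) hD

/-- The crux along this skeleton, from the registered stubs (sorries only inside `stub_*`). -/
theorem CurvatureAmnesia_skeleton : CurvatureAmnesia :=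
  CurvatureAmnesia_of stub_curvatureKernelBound stub_diagonalMirrorRPR stub_temperedCurvatureMoments
    stub_curvatureSandwichBound

/-! ### The shared crux under its other route name
`ScalingWindowSplit.CurvatureAmnesia` (item stmt-QuantumFields-16192 is wanted_by both routes; the two route copies are
verbatim, hence definitionally equal): `CurvatureAmnesia_of` closes it by the same term — see the folder/evidence file
`ScalingWindowSplitCurvatureAmnesiaSplit.lean` (`scalingWindowSplit_curvatureAmnesia_of_subs`, sorry-free), not restated here
so that this workfile does not import the `ScalingWindowSplit` route file. -/

end Summit.QuantumFields.YangMills.Cruxes.CurvatureAmnesia.MirrorBoostTransfer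

end
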